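import Summits.BirchSwinnertonDyer.BirchSwinnertonDyer.Theorems.GenusKolyvaginAtTwoShaCardDvdPowAtTwoRTPairSandwichSignFree
import Summits.BirchSwinnertonDyer.BirchSwinnertonDyer.Theorems.GenusKolyvaginAtTwoShaCardDvdPowAtTwoPosTOnCutRankQ
import Summits.BirchSwinnertonDyer.BirchSwinnertonDyer.Theorems.GenusKolyvaginAtTwoShaCardDvdPowAtTwoRTSharpExponentRat
import Literature.NumberTheory.EllipticCurves.SelmerGroupCardinality
import Literature.NumberTheory.EllipticCurves.BSDSelmerProofs
import Summits.BirchSwinnertonDyer.BirchSwinnertonDyer.Theorems.GenusKolyvaginAtTwoShaCardDvdPowAtTwoPosTB2QSignFree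
import Summits.BirchSwinnertonDyer.BirchSwinnertonDyer.Theses.GenusKolyvaginAtTwo
import HarnessLib

/-!
# Route `GenusKolyvaginAtTwo`, crux L⁺_T′ `PowDvdShaCardAtTwoPosT` (stmt-BirchSwinnertonDyer-25501), road (E4)⁺ — STUB R⁺ CLOSED:
# `rank E(K) ≤ 1` ON THE Δ>0 CUT, from Q2 + B2Q⁺ + the 2-Selmer-minimal twin (no Kolyvagin descent over `K`)

Seat `bsd-line-gk2-p2` g22 (PROVER seat 2/3, cell `bsd-f1-sign2`), `--supports stmt-BirchSwinnertonDyer-25501` (helper; closes nothing — it is the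
stub `stub_rankLeOnePosCut` of this seat's (E4)⁺ skeleton `Cruxes/PowDvdShaCardAtTwoPosT/Lines/plus_descent_e4pos.lean` by name and signature).
THEOREMS ONLY (no definition, no named fact, no `sorry`).  BSD is NOT proved by any of this; L⁺_T′ is NOT proved.

WHAT.  `mordellWeilRank_baseChange_le_one_onPosCut` — on the frame of L⁺_T′ (Q2; `W` non-CM with odd Tamagawa product and an odd multiplicative place;
`K` imaginary quadratic, `d_K` odd `≠ −3`, Heegner, the two non-square clauses; `ρ_{E,2^n}` onto; `d₁` with `P(1)` of infinite order and `2^{M₀+1} ∤ P(1)`;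
the cut `w(E) = 1`, a globally minimal twin model `Wd` with `#Sel₂(Wd) = 2`): **`rank E(K) ≤ 1`**.  Proof = three landed steps: B2Q⁺ by name
(`PlusDescent.stub_b2qSignFree`, gk2-p5 g31 p755582: `2^{M₀} · Sel_(2^M)(E/ℚ) = 0`) ⟹ `rank E(ℚ) = 0` (Kummer: `E(ℚ)/2^{M₀+1} ↪ Sel`, gk2-p3 g27's
`mordellWeilRank_eq_zero_of_two_pow_smul_selmer_eq_zero`) ⟹ `rank E(K) = rank E(ℚ) + rank E^{d_K}(ℚ) ≤ 0 + 1` (`#Sel₂(Wd) = 2` bounds the twin's rank;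
the rank part of gk2-p3 g27's `exists_frame_of_cut`).  FARM NOTE (as in the LEAD's p757977): gk2-p3's module `…ShaCardDvdPowAtTwoPosTOnCut` (p754542,
ACCEPTED 01:20Z) has no olean on the farm (OPS ask 02:47Z), so its two lemmas are re-proved here VERBATIM as `private` copies (attributed; no new public
API, no duplicate public statement); when it builds, the private copies can be replaced by imports.  (R⁺ was input (1) of LEAD R10: «free on the cut».)

References: [Kolyvagin1989Izv] Thm. B₂; [Kramer1981] Thm. 1; [SilvermanAEC2009] §VIII.2, Thm. X.4.2 (a); [GrossLMS1991] §5 Prop. 5.3.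
-/

set_option autoImplicit false
set_option linter.dupNamespace false

noncomputable section

open scoped Classical

namespace Summit.BirchSwinnertonDyer.BirchSwinnertonDyer.Theorems.GenusExact.PlusDescent

open Literature.NumberTheory.EllipticCurves Literature.NumberTheory.GaloisRepresentations WeierstrassCurve NumberField
  IsDedekindDomain Field AddSubgroup Literature.NumberTheory.EllipticCurves.ModularForms
  Literature.NumberTheory.EllipticCurves.RingClassField
open Summit.BirchSwinnertonDyer.Rank1Residual
open Summit.BirchSwinnertonDyer.BirchSwinnertonDyer.Theses.GenusKolyvaginAtTwo (KolyvaginRelationAtTwo)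

/-! ## §0 Private copies of gk2-p3 g27's two Kummer lemmas (module `…PosTOnCut`, olean unavailable on the farm) -/

section RankZero

variable {F : Type} [Field F] [NumberField F] (V : WeierstrassCurve F) [V.IsElliptic]

/-- (Private copy of gk2-p3 g27's `finrank_eq_zero_of_pow_smul_le_pow_succ_smul`, `…PosTOnCut`.)  A finitely generated abelian group with
`2^(M₀) A ⊆ 2^(M₀+1) A` has rank `0`. [folklore] -/
private theorem finrank_eq_zero_of_pow_smul_le_pow_succ_smul_inl {A : Type*} [AddCommGroup A] [Module.Finite ℤ A] {M₀ : ℕ}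
    (h : ∀ a : A, ∃ b : A, ((2 ^ (M₀ + 1) : ℕ) : ℤ) • b = ((2 ^ M₀ : ℕ) : ℤ) • a) : Module.finrank ℤ A = 0 := by
  set n₀ : ℕ := 2 ^ M₀ with hn₀
  set n₁ : ℕ := 2 ^ (M₀ + 1) with hn₁
  haveI : NeZero n₀ := ⟨by positivity⟩
  haveI : NeZero n₁ := ⟨by positivity⟩
  set R₀ := (zsmulAddGroupHom (α := A) (n₀ : ℤ)).range with hR₀
  set R₁ := (zsmulAddGroupHom (α := A) (n₁ : ℤ)).range with hR₁
  -- `2^(M₀+1) A ≤ 2^(M₀) A` and, by `h`, `2^(M₀) A ≤ 2^(M₀+1) A`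
  have hle : R₁ = R₀ := by
    apply le_antisymm
    · rintro _ ⟨a, rfl⟩
      refine ⟨(2 : ℤ) • a, ?_⟩
      have hc : ((n₀ : ℕ) : ℤ) * 2 = ((n₁ : ℕ) : ℤ) := by simp [hn₀, hn₁, pow_succ]
      change ((n₀ : ℕ) : ℤ) • ((2 : ℤ) • a) = ((n₁ : ℕ) : ℤ) • a
      rw [smul_smul, hc]
    · rintro _ ⟨a, rfl⟩
      obtain ⟨b, hb⟩ := h a
      exact ⟨b, by simpa only [zsmulAddGroupHom_apply] using hb⟩
  have h0 := natCard_quotient_range_zsmul_eq_pow_mul_card_torsionBy (A := A) n₀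
  have h1 := natCard_quotient_range_zsmul_eq_pow_mul_card_torsionBy (A := A) n₁
  have heq : Nat.card (A ⧸ R₁) = Nat.card (A ⧸ R₀) := by rw [hle]
  rw [← hR₀] at h0
  rw [← hR₁] at h1
  rw [h0, h1] at heq
  -- `A[2^M₀] ≤ A[2^(M₀+1)] ≤ A_tors`, finite
  haveI hTfin : Finite (AddCommGroup.torsion A) := by
    have hfin : Finite (Submodule.torsion ℤ A) :=
      Module.finite_of_fg_torsion (Submodule.torsion ℤ A) (Submodule.torsion_isTorsion)
    rw [← Submodule.torsion_int]
    exact hfin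
  have hleT : torsionBy A (n₁ : ℤ) ≤ AddCommGroup.torsion A := fun a ha ↦ by
    rw [mem_torsionBy_iff] at ha
    exact (AddCommGroup.mem_torsion a).mpr (isOfFinAddOrder_iff_zsmul_eq_zero.mpr ⟨n₁, by exact_mod_cast (NeZero.ne n₁), ha⟩)
  haveI : Finite (torsionBy A (n₁ : ℤ)) := Finite.of_injective _ (AddSubgroup.inclusion_injective hleT)
  have htors : Nat.card (torsionBy A n₀) ≤ Nat.card (torsionBy A n₁) := by
    refine AddSubgroup.card_le_of_le fun a ha ↦ ?_
    rw [mem_torsionBy_iff] at ha ⊢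
    rw [hn₁, pow_succ, Nat.cast_mul, mul_comm, mul_smul, ← hn₀]
    rw [ha, smul_zero]
  have hpos : 0 < Nat.card (torsionBy A n₁) := Nat.card_pos
  -- `2^((M₀+1)·rk) · #A[2^(M₀+1)] = 2^(M₀·rk) · #A[2^M₀] ≤ 2^(M₀·rk) · #A[2^(M₀+1)]`
  set r := Module.finrank ℤ A with hr
  have hineq : n₁ ^ r * Nat.card (torsionBy A n₁) ≤ n₀ ^ r * Nat.card (torsionBy A n₁) := by
    calc n₁ ^ r * Nat.card (torsionBy A n₁) = n₀ ^ r * Nat.card (torsionBy A n₀) := heq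
      _ ≤ n₀ ^ r * Nat.card (torsionBy A n₁) := Nat.mul_le_mul_left _ htors
  have hpow : n₁ ^ r ≤ n₀ ^ r := Nat.le_of_mul_le_mul_right hineq hpos
  by_contra hr0
  have hr1 : 1 ≤ r := Nat.one_le_iff_ne_zero.mpr hr0
  have hlt : n₀ ^ r < n₁ ^ r := by
    apply Nat.pow_lt_pow_left ?_ hr0
    rw [hn₀, hn₁, pow_succ]
    have : 0 < 2 ^ M₀ := by positivity
    omega
  omega

/-- (Private copy of gk2-p3 g27's `mordellWeilRank_eq_zero_of_two_pow_smul_selmer_eq_zero`, `…PosTOnCut`.)  If `2^(M₀)` kills `Sel_(2^(M₀+1))(E/F)` then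
`rank E(F) = 0`. [cite: SilvermanAEC2009, §VIII.2 and Thm. X.4.2 (a)] -/
private theorem mordellWeilRank_eq_zero_of_two_pow_smul_selmer_eq_zero_inl {M₀ : ℕ}
    (hSel : ∀ s : galH1Torsion V ((2 ^ (M₀ + 1) : ℕ) : ℤ), s ∈ selmerGroup V ((2 ^ (M₀ + 1) : ℕ) : ℤ) → ((2 ^ M₀ : ℕ) : ℤ) • s = 0) :
    V.mordellWeilRank = 0 := by
  haveI : Module.Finite ℤ V.toAffine.Point := V.module_finite_point_holds
  have hn : ((2 ^ (M₀ + 1) : ℕ) : ℤ) ≠ 0 := by positivity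
  obtain ⟨κ, hker, hrange⟩ := V.exists_kummerMap_holds hn
  unfold WeierstrassCurve.mordellWeilRank
  refine finrank_eq_zero_of_pow_smul_le_pow_succ_smul_inl (M₀ := M₀) fun P ↦ ?_
  -- `κ(2^M₀ P) = 2^M₀ κ(P) = 0`, so `2^M₀ P ∈ ker κ = 2^(M₀+1) E(F)`
  have hκP : κ P ∈ selmerGroup V ((2 ^ (M₀ + 1) : ℕ) : ℤ) := by
    have : κ P ∈ κ.range := ⟨P, rfl⟩
    rw [hrange] at this
    exact (AddSubgroup.mem_inf.mp this).1
  have hmem : ((2 ^ M₀ : ℕ) : ℤ) • P ∈ κ.ker := by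
    rw [AddMonoidHom.mem_ker, map_zsmul]
    exact hSel _ hκP
  rw [hker] at hmem
  obtain ⟨b, hb⟩ := hmem
  exact ⟨b, by simpa only [zsmulAddGroupHom_apply] using hb⟩

end RankZero

/-! ## §1 R⁺: `rank E(K) ≤ 1` on the Δ>0 cut -/

/-- **STUB R⁺ of the (E4)⁺ skeleton, CLOSED: `rank E(K) ≤ 1` on the cut of L⁺_T′** (signature = `stub_rankLeOnePosCut` of
`Cruxes/PowDvdShaCardAtTwoPosT/Lines/plus_descent_e4pos.lean` VERBATIM).  B2Q⁺ by name ⟹ `rank E(ℚ) = 0` ⟹ `rank E(K) = rank E(ℚ) + rank E^{d_K}(ℚ) ≤ 1`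
(`#Sel₂(Wd) = 2`).  No sign of `Δ` is used (the hypotheses `v`, non-squares, … only feed B2Q⁺). (Rank bookkeeping adapted from gk2-p3 g27's
`exists_frame_of_cut`.) [cite: Kolyvagin1989Izv, Thm. B₂] [cite: Kramer1981, Thm. 1] [cite: SilvermanAEC2009, Thm. X.4.2 (a)] -/
theorem mordellWeilRank_baseChange_le_one_onPosCut : KolyvaginRelationAtTwo → ∀ (W : WeierstrassCurve ℚ) [W.IsElliptic] [W.IsGloballyMinimal]
    [NeZero (W.conductorNorm ℤ)],
    ¬ W.HasCM → Odd W.tamagawaProduct → ∀ (v : HeightOneSpectrum (𝓞 ℚ)), ((2 : ℕ) : 𝓞 ℚ) ∉ v.asIdeal →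
    ((W.conductorNorm ℤ : ℕ) : 𝓞 ℚ) ∈ v.asIdeal → W.HasMultiplicativeReductionAt v →
    ∀ (K : Type) [Field K] [NumberField K], IsImaginaryQuadratic K → Odd (NumberField.discr K) → NumberField.discr K ≠ -3 →
    SatisfiesHeegnerHypothesis (W.conductorNorm ℤ) K → ¬ IsSquare ((NumberField.discr K : ℚ) * -|W.Δ|) →
    ¬ IsSquare ((NumberField.discr K : ℚ) * (-(2 * |W.Δ|))) → (∀ n : ℕ, 0 < n → W.HasSurjectiveModNGaloisRep ((2 : ℤ) ^ n)) →
    ∀ (Dt : ModularParametrizationData W (W.conductorNorm ℤ)) (β : ℤ) (ι : K →+* ℂ) (d₁ : KolyvaginHeegnerData Dt β ι 1),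
    ¬ IsOfFinAddOrder d₁.derivedPoint → ∀ (M₀ : ℕ),
    (¬ ∃ Q : (W.baseChange (ringClassField K ι 1)).toAffine.Point, ((2 ^ (M₀ + 1) : ℕ) : ℤ) • Q = d₁.derivedPoint) →
    W.rootNumber = 1 → ∀ (Wd : WeierstrassCurve ℚ) [Wd.IsElliptic] [Wd.IsGloballyMinimal],
    (∃ C : VariableChange ℚ, C • W.quadraticTwist (NumberField.discr K : ℚ) = Wd) → Nat.card (Wd.selmerGroup 2) = 2 →
    (W.baseChange K).mordellWeilRank ≤ 1 := by
  intro hQ2 W _ _ _ hcm hT v h2v hNv hmult K _ _ hIQ hodd h3 hHe hsq1 hsq2 hρ Dt β ι d₁ _hy M₀ hndiv hw Wd _ _ hWd hSel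
  -- `rank E(ℚ) = 0` from B2Q⁺ (Kummer)
  have hB2Q := stub_b2qSignFree hQ2 W hcm hT v h2v hNv hmult K hIQ hodd h3 hHe hsq1 hsq2 hρ Dt β ι d₁ M₀ hndiv hw
  have hrk0 : W.mordellWeilRank = 0 := mordellWeilRank_eq_zero_of_two_pow_smul_selmer_eq_zero_inl W (hB2Q (M₀ + 1))
  -- the twist `T = E^{d_K}` and `#Sel₂(T) = 2`
  have h2 : Module.finrank ℚ K = 2 := hIQ.1
  have hdK : (NumberField.discr K : ℚ) ≠ 0 := by exact_mod_cast NumberField.discr_ne_zero K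
  haveI hTell : (W.quadraticTwist (NumberField.discr K : ℚ)).IsElliptic := W.isElliptic_quadraticTwist hdK
  set T := W.quadraticTwist (NumberField.discr K : ℚ) with hTdef
  haveI : Module.Finite ℤ (W.baseChange K).toAffine.Point := (W.baseChange K).module_finite_point_holds
  have hsum : (W.baseChange K).mordellWeilRank = W.mordellWeilRank + T.mordellWeilRank :=
    W.mordellWeilRank_baseChange_of_finrank_eq_two_of_finite K h2
  obtain ⟨Cd, hCd⟩ := hWd
  have hSelT : Nat.card (T.selmerGroup 2) = 2 := by
    have h := natCard_selmerGroup_smul T Cd (n := 2) two_ne_zero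
    simp only [Nat.cast_ofNat] at h
    rw [← h, hCd, hSel]
  -- the descent count for `T`: `2 = 2^(rank T) · #T(ℚ)[2] · #(Ш ⊓ H¹[2])` forces `rank T ≤ 1`
  have hcount := card_selmerGroup_eq_pow_rank_mul T 2
  simp only [Nat.cast_ofNat] at hcount
  rw [hSelT] at hcount
  have hrkT : T.mordellWeilRank ≤ 1 := by
    have hdvd : 2 ^ T.mordellWeilRank ∣ 2 := Dvd.intro _ (by rw [mul_assoc] at hcount; exact hcount.symm)
    have hle := Nat.le_of_dvd two_pos hdvd
    by_contra h
    have h4 : 4 ≤ 2 ^ T.mordellWeilRank := by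
      calc 4 = 2 ^ 2 := by norm_num
        _ ≤ 2 ^ T.mordellWeilRank := Nat.pow_le_pow_right (by norm_num) (by omega)
    omega
  rw [hsum, hrk0, zero_add]
  exact hrkT

end Summit.BirchSwinnertonDyer.BirchSwinnertonDyer.Theorems.GenusExact.PlusDescent

end
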